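import Literature.MathematicalPhysics.QuantumFieldTheory.Balaban1983to89.B9CoReadingCoordsInput

/-!
# `Balaban1983to89.B9CoReadingCoordsInputLoc` — [Balaban1985BackgroundPropagators] (3.39)–(3.41), (3.44) pp. 397–398; [Balaban1984PropagatorsII] (2.51)–(2.52) p. 232:
# THE CLASS-LOCALISED INPUT NORM `bHK` AGAINST THE FIBRE BLOCKS `ofBlocks (blkBK bI)` — the two facts the class-multiplicity transfer needs at the N06 pins

statement-level skeleton of published theorems with citation tags; proofs where landed; nothing here is a claim about the Yang–Mills mass gap

WHY THIS FILE (located «INPUT-LOC-CLASS-VS-FIBRE», dag-n06-w3 g2 `B9Letters313IMBLocObstruction`; repair «R2-loc», dag-n06-l g15 `Letters313IMBC`).  The input norm of print's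
(3.44), `B9CoReadingCoordsInput.bHK i bI ε` (dag-n06-d g6), localises a coordinate function at an index bond `y′` when it vanishes off the CARRIER CLASS of `y′`
(`RelB`: same carrier block — print's `supp λ ⊂ Δ̃(y′)`); the walk letters' sup classes `BlockNorm.ofBlocks … (blkBK i bI)` localise at ONE FIBRE `bI⁻¹ y′`.  The repaired
schema `Letters313IMBC` (n06-l) asks, in place of the false `locX` (class ⊆ fibre), for the two TRUE relations between them — the hypotheses `hvanish ∕ hle` of
`B9BlockNormClassTransfer.hasMaj_of_dom_classes`: (v) the fibre pieces of a class-localised function vanish outside the class; (d) each fibre piece inside the class is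
bounded, in the fibre sup norm, by the input norm.  THIS FILE proves both at the letters, for every `ε`, so the certificate discharges `hLIM.vanishX ∕ hLIM.leX` as co-readings.

## WHAT IS PROVED (sorry-free, standard axioms)

* ★ `cut_ofBlocks_eq_zero_of_isLoc_bHK` — `(bHK i bI ε).IsLoc y′ μ → ¬ RelB i y″ y′ → (ofBlocks (toB6 (geo9K i) R H) (blkBK i bI)).cut y″ μ = 0`.
* ★ `loc_ofBlocks_cut_le_loc_bHK` — `RelB i y″ y′ → (ofBlocks …).loc y″ ((ofBlocks …).cut y″ μ) ≤ (bHK i bI ε).loc y′ μ` (fibre sup ≤ class sup `supK` ≤ `supK + holK`).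
* `vanishX_bHK_pins ∕ leX_bHK_pins` — the same in the `∀ ε, 0 < ε → …` binder shape of `Letters313IMBC.vanishX ∕ .leX`.

HONEST FRAMING.  Finite bookkeeping about two block norms; nothing of [B9] asserted; COUNT-NEUTRAL; N06 NOT discharged; nothing continuum ∕ OS ∕ mass-gap ∕ Clay.
Cell `pub-ymgap` (D-0062), node N06 [B9], seat `pub-ymgap-dag-n06-d` (gen 9).  A NEW file.
-/

namespace Literature.MathematicalPhysics.QuantumFieldTheory.Balaban1983to89.B9CoReadingCoordsInputLoc

open B6KLevelCensusIndexV1 (KIdx)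
open B9GeoNormsKLevelV1 (geo9K)
open B9Thm34Ext (toB6)
open B11SectG (BlockNorm)
open B6RandomWalk (blockPiece)
open B9CoReadingCoords (XBK blkBK)
open B9CoRealizesRelAtLetters (RelB)
open B9CoReadingCoordsInput (bHK supK holK restrK supK_nonneg holK_nonneg)
open Node00 (FBondY IBondY)

noncomputable section

variable {d ℓ : ℕ} {hd : 1 ≤ d + 1} {hL : Odd (ℓ + 1) ∧ 1 < ℓ + 1} {b₀ b₁ : ℝ}
variable {κ : Type} [Fintype κ]
variable (i : KIdx d ℓ hd hL b₀ b₁) [Fintype (geo9K i).Site] [DecidableRel (RelB i)] (bI : FBondY i → IBondY i) {R : ℝ} {H : Prop}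

/-- ★ **(v) THE FIBRE PIECES OF A CLASS-LOCALISED FUNCTION VANISH OUTSIDE THE CLASS**: if `μ` vanishes off the carrier class of `y′` (`bHK`-localised) and `y″` is not in
that class, the `y″`-fibre piece of `μ` is zero. [cite: Balaban1985BackgroundPropagators, (3.44) p.398 («supp λ ⊂ Δ(y′)»); Balaban1984PropagatorsII, (2.45) p.231, bookkeeping] -/
theorem cut_ofBlocks_eq_zero_of_isLoc_bHK (ε : ℝ) {y' y'' : IBondY i} {μ : XBK κ i → ℝ}
    (hμ : (bHK i bI ε (R := R) (H := H)).IsLoc y' μ) (hy : ¬ RelB i y'' y') :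
    (BlockNorm.ofBlocks (toB6 (geo9K i) R H) (blkBK i bI)).cut y'' μ = 0 := by
  have hpt : ∀ p : XBK κ i, blockPiece (g := toB6 (geo9K i) R H) (blkBK i bI) y'' μ p = 0 := fun p => by
    unfold blockPiece
    split_ifs with h
    · have h' : bI p.1 = y'' := h
      exact hμ p (fun hr => hy (h' ▸ hr))
    · rfl
  exact funext hpt

/-- ★ **(d) A FIBRE PIECE INSIDE THE CLASS IS BOUNDED BY THE INPUT NORM**: for `y″` in the carrier class of `y′`, the fibre sup of the `y″`-piece of `μ` is at most
`supK y′ μ ≤ supK y′ μ + holK ε y′ μ = (bHK i bI ε).loc y′ μ`. [cite: Balaban1985BackgroundPropagators, (3.39)–(3.41) p.397, (3.44) p.398; Balaban1984PropagatorsII, (2.51)–(2.52) p.232, bookkeeping] -/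
theorem loc_ofBlocks_cut_le_loc_bHK (ε : ℝ) {y' y'' : IBondY i} (μ : XBK κ i → ℝ) (hy : RelB i y'' y') :
    (BlockNorm.ofBlocks (toB6 (geo9K i) R H) (blkBK i bI)).loc y'' ((BlockNorm.ofBlocks (toB6 (geo9K i) R H) (blkBK i bI)).cut y'' μ) ≤
      (bHK i bI ε (R := R) (H := H)).loc y' μ := by
  classical
  refine le_trans ?_ (le_add_of_nonneg_right (holK_nonneg i bI ε y' μ))
  -- the fibre sup of the `y″`-piece, entry by entry against the class sup `supK y′ μ`
  change (⨆ p : XBK κ i, _) ≤ supK i bI y' μ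
  refine Real.iSup_le (fun p => ?_) (supK_nonneg i bI y' μ)
  split_ifs with h
  · have h' : bI p.1 = y'' := h
    have hrel : RelB i (bI p.1) y' := h' ▸ hy
    have hp : ((BlockNorm.ofBlocks (toB6 (geo9K i) R H) (blkBK i bI)).cut y'' μ) p = restrK i bI y' μ p := by
      show blockPiece (g := toB6 (geo9K i) R H) (blkBK i bI) y'' μ p = restrK i bI y' μ p
      unfold blockPiece restrK
      rw [if_pos hrel]
      split_ifs; rfl
    rw [hp]
    exact le_ciSup (Finite.bddAbove_range fun p : XBK κ i => |restrK i bI y' μ p|) p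
  · exact supK_nonneg i bI y' μ

/-- (v) in the `ε`-indexed binder shape of `Letters313IMBC.vanishX` at the pins `bHX := fun ε => bHK i bI ε`, `blk := blkBK i bI`, `Rel := RelB i`.
[cite: Balaban1985BackgroundPropagators, (3.44) p.398, bookkeeping] -/
theorem vanishX_bHK_pins : ∀ ε : ℝ, 0 < ε → ∀ (y' : IBondY i) (μ : XBK κ i → ℝ), (bHK i bI ε (R := R) (H := H)).IsLoc y' μ →
    ∀ y'' : IBondY i, ¬ RelB i y'' y' → (BlockNorm.ofBlocks (toB6 (geo9K i) R H) (blkBK i bI)).cut y'' μ = 0 :=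
  fun ε _ _ _ hμ _ hy => cut_ofBlocks_eq_zero_of_isLoc_bHK i bI ε hμ hy

/-- (d) in the `ε`-indexed binder shape of `Letters313IMBC.leX` at the same pins. [cite: Balaban1985BackgroundPropagators, (3.44) p.398, bookkeeping] -/
theorem leX_bHK_pins : ∀ ε : ℝ, 0 < ε → ∀ (y' : IBondY i) (μ : XBK κ i → ℝ), (bHK i bI ε (R := R) (H := H)).IsLoc y' μ →
    ∀ y'' : IBondY i, RelB i y'' y' →
      (BlockNorm.ofBlocks (toB6 (geo9K i) R H) (blkBK i bI)).loc y'' ((BlockNorm.ofBlocks (toB6 (geo9K i) R H) (blkBK i bI)).cut y'' μ) ≤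
        (bHK i bI ε (R := R) (H := H)).loc y' μ :=
  fun ε _ _ μ _ _ hy => loc_ofBlocks_cut_le_loc_bHK i bI ε μ hy

end

end Literature.MathematicalPhysics.QuantumFieldTheory.Balaban1983to89.B9CoReadingCoordsInputLoc
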